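import Summits.Ventures.DiscreteObjects.UnitDistance.PlaneSqrt11Rup1
import HarnessLib

/-!
# A second, independent kernel certificate that `W_11` is not 3-colourable (RUP instead of backtracking)

Framing (verbatim for the cell): lottery ticket; floor = certified bounds/negative ranges.

Cell `pub-namedobj`, target (U), seat udg g12.  `PlaneSqrt11Four.lean` proves `¬ W_11.Colorable 3` by the kernel-evaluated
backtracking search of `KernelColouringSearch.lean`.  Here the same statement is re-derived by a different route: the CDCL
refutation of the 3-colouring CNF (`KRup.cnfOf w11nb 109 43 94`, 855 clauses) found by `code/udg12/cdcl.c` is re-played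
clause by clause by the kernel RUP checker (`KernelRupCheck.lean`, 55 steps in 1 piece(s)); soundness
`KRup.checkAll_sound` + the clause recogniser `KRup.validClause_true`.  Two kernel certificates, two external engines.
-/

noncomputable section

namespace Summit.Ventures.DiscreteObjects.UnitDistance

open SimpleGraph KRup

/-- KERNEL FACT: every clause of the 3-colouring CNF has an admissible shape (vertex / edge-of-the-graph / unit). -/
theorem w11cnf_valid : (cnfOf w11nb 109 43 94).all (validClause w11nb 109 43 94) = true := by
  decide +kernel

/-- KERNEL FACT: the last piece of the certificate derives the empty clause. -/
theorem w11nil : ([] : List ℕ) ∈ w11steps1.map Prod.fst := by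
  decide +kernel


set_option maxRecDepth 2000000 in
/-- `W_11` IS NOT 3-COLOURABLE — by the RUP certificate. -/
theorem not_colorable_three_w11Graph_rup : ¬ w11Graph.Colorable 3 := by
  rintro ⟨C⟩
  have h01 : C ⟨43, by norm_num⟩ ≠ C ⟨94, by norm_num⟩ := C.valid w11_edge01
  obtain ⟨σ, hσ0, hσ1⟩ := exists_perm_fin3 _ _ h01
  let col : ℕ → ℕ := fun v => if h : v < 109 then (σ (C ⟨v, h⟩)).val else 0
  have hcol : ∀ v (h : v < 109), col v = (σ (C ⟨v, h⟩)).val := fun v h => dif_pos h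
  have hP : Proper3 w11nb 109 col := by
    intro v hv
    refine ⟨by rw [hcol v hv]; exact (σ (C ⟨v, hv⟩)).isLt, ?_⟩
    intro w hw hbit heq
    have hu := (w11_unit_of_testBit v w hv hbit).2
    have hvalid : C ⟨v, hv⟩ ≠ C ⟨w, hw⟩ := C.valid hu
    rw [hcol v hv, hcol w hw] at heq
    exact hvalid (σ.injective (Fin.ext heq)).symm
  have h0 : col 43 = 0 := by rw [hcol 43 (by norm_num), hσ0]; rfl
  have h1 : col 94 = 1 := by rw [hcol 94 (by norm_num), hσ1]; rfl
  have H0 := all_true_of_valid hP h0 h1 w11cnf_valid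
  have A1 : ∀ C ∈ cnfOf w11nb 109 43 94 ++ w11pre1, clauseTrue (assignOf col) C = true := by
    intro C hC; rw [List.mem_append] at hC
    rcases hC with h | h
    · exact H0 C h
    · simp [w11pre1] at h
  have S1 : ∀ C ∈ w11steps1.map Prod.fst, clauseTrue (assignOf col) C = true :=
    checkAll_sound (σ := assignOf col) 173 11 (S := Store.ofList 11 (cnfOf w11nb 109 43 94 ++ w11pre1))
      _ w11steps1 (Store.All.ofList 11 A1) w11rup1
  have hnil := S1 [] w11nil
  simp [clauseTrue] at hnil

end Summit.Ventures.DiscreteObjects.UnitDistance
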